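import Literature.NumberTheory.Automorphic.PosRootGroupDimension
import Literature.NumberTheory.Automorphic.RootSubgroupUnique
import Literature.NumberTheory.Automorphic.IsomorphismTheoremUniqueLieHolds
import HarnessLib

/-!
# The commutator relations (Springer 8.2.3): Springer's proof from 8.2.1, and the discharge
`rootSubgroup_commutator_le_holds` in every characteristic

Trunk T-AUTOMORPHIC (G25 AutomorphicL); sibling proof file of `RootSubgroupCommutators.lean`
(namespace `Literature.NumberTheory.Automorphic`), devoted to the named fact
`rootSubgroup_commutator_le` vendored there: Springer, *Linear Algebraic Groups* (2nd ed.),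
Prop. 8.2.3 in corollary form — for roots `α_i ≠ ±α_j` of a connected reductive `G` relative to a
maximal torus `T` (over an algebraically closed field), `(U_{α_i}, U_{α_j})` lies in the group
generated by the `U_{c α_i + d α_j}`, `c, d > 0`. (The file cannot be appended to the fact's own
file: the inputs below live in `BigCellReduction.lean`, `RootProductRetraction.lean` and
`PosRootGroupDimension.lean`, which import it.)

Springer's printed proof (p. 144): *by 8.2.1, `(u_α(x), u_β(y)) = ∏_{γ ∈ R⁺} u_γ(P_γ(x, y))` with
polynomials `P_γ`; conjugating by `t ∈ T` gives `P_γ(α(t)x, β(t)y) = γ(t) P_γ(x, y)`, so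
`P_γ ≠ 0` only if `γ = iα + jβ` with `i, j ≥ 0`; and `j = 0` is impossible — putting `y = 0` the
commutator is `1`* (the reduction to `α, β ∈ R⁺` is by 7.5.2 and 8.1.12 (2)). This file proves:

* `RootPairing.exists_root'_pos_and_root'_pos_or` — for two roots `α_i, α_j` of a finite root
  pairing over `ℤ`, either some coweight `y` has `⟨α_i, y⟩ > 0`, `⟨α_j, y⟩ > 0`, or
  `s α_i + t α_j = 0` with `s, t > 0` (from the positive semi-definite canonical form, Mathlib
  `RootPairing.RootForm`; this replaces Springer's reduction to `R⁺` via the Weyl group and needs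
  no reducedness);
* `coeff_bind₁_C_mul_X` — rescaling the variables of a polynomial, `X_s ↦ w_s X_s`, multiplies the
  `X^d`-coefficient by `∏ w_s^{d_s}` (the bookkeeping behind "linear independence of characters");
* **`commutatorElement_mem_iSup_rootSubgroup_of_range_rootProd`** — Springer's argument, in any
  characteristic, for `T ≤ G ≤ GL_n` over an infinite field, a root datum `P` with root
  homomorphisms `u_m`, and a coweight `y` such that the product map `x ↦ ∏_{m ∈ l} u_m(x_m)` onto
  `U(y) = ⟨u_m(𝔾ₐ) : ⟨α_m, y⟩ > 0⟩` is surjective with a polynomial left inverse (the two halves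
  of 8.2.1, as hypotheses): for `y`-positive `α_i, α_j`, `(u_i(a), u_j(b))` lies in
  `⟨U_{α_m} : α_m = c α_i + d α_j, c, d > 0⟩`;
* `commutator_rootSubgroup_le_of_range_rootProd` — the same for the subgroups `(U_{α_i}, U_{α_j})`,
  granted 8.1.1 (i) (`rootSubgroup_unique`: `U_α = u_α(𝔾ₐ)`);
* **`rootSubgroup_commutator_le_of_rootSubgroup_unique`** — in characteristic `0`,
  `rootSubgroup_unique → rootSubgroup_commutator_le`: both halves of 8.2.1 are theorems there
  (`exists_polyRetraction_prod_rootHom`, `RootProductRetraction.lean`;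
  `posRootGroup_subset_range_rootProd`, `PosRootGroupDimension.lean`, by a dimension count using
  `dim 𝔤_α ≤ 1`, `finrank_lieWeightSpace_le_one_of_rootSubgroup_unique`), and the degenerate case
  of the coweight dichotomy is trivial (`U_{α_i}`, `U_{α_j}` are among the generators).

Since 8.1.1 (i) is now a theorem of the tree in every characteristic (`rootSubgroup_unique_holds`,
`RootSubgroupUnique.lean`), the fact holds outright in characteristic `0`
(`rootSubgroup_commutator_le_of_charZero`). **Every characteristic** (second part of the file):

* `IsRootHom.exists_coeff_one_ne_zero_of_conj`, **`exists_polyRetraction_prod_rootHom'`** — the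
  injectivity half of 8.2.1 (polynomial left inverse of `x ↦ ∏_{m ∈ l} u_m(x_m)`) without the
  characteristic-`0` hypothesis of `exists_polyRetraction_prod_rootHom`: the non-vanishing of the
  linear terms of the `u_m` comes from the retraction clause of `IsRootHom` (the `u_m` are
  isomorphisms onto their images, 8.1.1 (i)) instead of `coeff_eq_zero_of_coeff_one_eq_zero`;
* `lieAlgebraGL_posRootGroup_le_of_subset`, `zdim_posRootGroup_le_of_subset`,
  **`posRootGroup_subset_range_rootProd_of_subset`** — the surjectivity half of 8.2.1 for `U(y)` by
  the dimension count of `PosRootGroupDimension.lean`, with its one characteristic-`0` input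
  (`P ⊆ R`, `lieWeights_subset_roots`, by exponentials) turned into a hypothesis;
* **`rootSubgroup_commutator_le_of_lieWeights_eq_roots`** —
  `lieWeights_eq_roots → rootSubgroup_commutator_le` in every characteristic: Springer 8.1.2
  (`P = R`, `dim 𝔤_α = 1`; the named fact of `IsomorphismTheoremUniqueLie.lean`) supplies both
  hypotheses of the dimension count, and 8.1.1 (i) is `rootSubgroup_unique_holds`.

The last leaf, Springer 8.1.2 (`lieWeights_eq_roots`, printed proof through the groups `G_α` of
semisimple rank one, 7.6.4 (i), 7.3.2–7.3.3), is the theorem `lieWeights_eq_roots_holds` of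
`IsomorphismTheoremUniqueLieHolds.lean` in every characteristic, whence the discharge
**`rootSubgroup_commutator_le_holds : rootSubgroup_commutator_le`**. Not here: the printed form of
8.2.3 with one monomial `c_{α,β;i,j} xⁱ yʲ` per root (which needs the linear independence of
`α, β`, 7.4.4) — only the corollary form is vendored.

## References

* [SpringerLAG1998] T. A. Springer, *Linear Algebraic Groups*, 2nd ed., Progress in Mathematics 9,
  Birkhäuser (1998): Prop. 8.2.1, Lemma 8.2.2, Prop. 8.2.3 and its proof (p. 144), 8.1.1 (i),
  Cor. 8.1.2, 7.4.4, 7.5.2, 8.1.12 (2).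
-/

open scoped MatrixGroups IsMulCommutative Pointwise commutatorElement
open MvPolynomial

namespace Literature.NumberTheory.Automorphic

/-! ### Rescaling the variables of a polynomial -/

section Rescale

variable {R : Type*} [CommSemiring R] {σ : Type*}

/-- Rescaling the variables `X_s ↦ w_s X_s` maps the monomial `r X^d` to `(∏ w_s^{d_s}) r X^d`.
[folklore] -/
theorem bind₁_C_mul_X_monomial (w : σ → R) (d : σ →₀ ℕ) (r : R) :
    bind₁ (fun s => C (w s) * X s) (monomial d r) =
      monomial d ((d.prod fun s e => w s ^ e) * r) := by
  classical
  rw [bind₁_monomial]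
  simp_rw [mul_pow, Finset.prod_mul_distrib, ← map_pow, ← map_prod]
  rw [monomial_eq, Finsupp.prod, Finsupp.prod, map_mul]
  ring

/-- **Rescaling the variables `X_s ↦ w_s X_s` multiplies the `X^d`-coefficient by `∏ w_s^{d_s}`.**
[folklore] -/
theorem coeff_bind₁_C_mul_X (w : σ → R) (p : MvPolynomial σ R) (d : σ →₀ ℕ) :
    coeff d (bind₁ (fun s => C (w s) * X s) p) = (d.prod fun s e => w s ^ e) * coeff d p := by
  classical
  induction p using MvPolynomial.induction_on' with
  | monomial d' r =>
    rw [bind₁_C_mul_X_monomial, coeff_monomial, coeff_monomial]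
    split_ifs with h
    · rw [h]
    · rw [mul_zero]
  | add p q hp hq => rw [map_add, coeff_add, coeff_add, hp, hq, mul_add]

/-- Evaluating the rescaled polynomial: `(p(w X))(v) = p(w v)`. [folklore] -/
theorem eval_bind₁_C_mul_X (w v : σ → R) (p : MvPolynomial σ R) :
    eval v (bind₁ (fun s => C (w s) * X s) p) = eval (fun s => w s * v s) p := by
  change eval₂Hom (RingHom.id R) v (bind₁ _ p) = _
  rw [eval₂Hom_bind₁]
  change eval (fun s => eval v (C (w s) * X s)) p = _
  simp

end Rescale

/-! ### Coweights positive on two given roots -/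

section Coweight

variable {ι X Y : Type*} [AddCommGroup X] [AddCommGroup Y]

/-- **Two roots are simultaneously positive on some coweight, unless they are negatively
proportional.** For roots `α_i, α_j` of a finite root pairing over `ℤ`, either there is a
coweight `y` with `⟨α_i, y⟩ > 0` and `⟨α_j, y⟩ > 0`, or `s α_i + t α_j = 0` for some integers
`s, t > 0`. From the positive semi-definite canonical form `( , )` of the root pairing (Mathlib
`RootPairing.RootForm`, `RootPairing.Polarization`): with `p = (α_i, α_i) > 0`,
`q = (α_j, α_j) > 0`, `r = (α_i, α_j)` one has `r² ≤ pq`; take `y` the polarization of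
`α_i + α_j` if `r ≥ 0`, of `(r² + pq) α_i - 2pr α_j` if `r < 0` and `r² < pq`, while `r² = pq`
forces `r α_i = p α_j`. Deliberate dot-notation extension of Mathlib's `RootPairing` namespace
(like `RootPairing.exists_forall_root'_ne_zero` of `BigCellReduction.lean`). [folklore] -/
theorem _root_.RootPairing.exists_root'_pos_and_root'_pos_or [Finite ι] (P : RootPairing ι ℤ X Y)
    (i j : ι) :
    (∃ y : Y, 0 < P.root' i y ∧ 0 < P.root' j y) ∨
      ∃ s t : ℕ, 0 < s ∧ 0 < t ∧ s • P.root i + t • P.root j = 0 := by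
  classical
  letI : Fintype ι := Fintype.ofFinite ι
  set p := P.RootForm (P.root i) (P.root i) with hpdef
  set q := P.RootForm (P.root j) (P.root j) with hqdef
  set r := P.RootForm (P.root i) (P.root j) with hrdef
  have hmem : ∀ m, P.root m ∈ P.rootSpan ℤ := fun m => Submodule.subset_span ⟨m, rfl⟩
  have hp : 0 < p := P.rootForm_pos_of_ne_zero (hmem i) (P.ne_zero i)
  have hq : 0 < q := P.rootForm_pos_of_ne_zero (hmem j) (P.ne_zero j)
  have hsymm' : ∀ x y : X, P.RootForm x y = P.RootForm y x := fun x y => by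
    simpa using P.rootForm_symmetric.eq x y
  have hsymm : P.RootForm (P.root j) (P.root i) = r := hsymm' _ _
  have key : ∀ x : X, ∀ m, P.root' m (P.Polarization x) = P.RootForm (P.root m) x := fun x m => by
    rw [hsymm']
    exact P.toLinearMap_apply_apply_Polarization x (P.root m)
  by_cases hr : 0 ≤ r
  · refine Or.inl ⟨P.Polarization (P.root i + P.root j), ?_, ?_⟩
    · rw [key, map_add, ← hpdef, ← hrdef]; omega
    · rw [key, map_add, hsymm, ← hqdef]; omega
  rw [not_le] at hr
  -- Cauchy–Schwarz for the positive semi-definite form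
  set v : X := r • P.root i - p • P.root j with hvdef
  have hvv : P.RootForm v v = p * (p * q - r * r) := by
    simp only [hvdef, map_sub, map_smul, LinearMap.sub_apply, LinearMap.smul_apply, smul_eq_mul,
      ← hpdef, ← hqdef, ← hrdef, hsymm]
    ring
  have hcs : r * r ≤ p * q := by
    have := P.zero_le_rootForm v
    rw [hvv] at this
    nlinarith
  rcases hcs.lt_or_eq with hlt | heq
  · refine Or.inl ⟨P.Polarization ((r * r + p * q) • P.root i + (-(2 * p * r)) • P.root j), ?_, ?_⟩
    · rw [key]
      simp only [map_add, map_smul, smul_eq_mul, ← hpdef, ← hrdef]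
      nlinarith
    · rw [key]
      simp only [map_add, map_smul, smul_eq_mul, hsymm, ← hqdef]
      nlinarith
  · refine Or.inr ⟨(-r).toNat, p.toNat, by omega, by omega, ?_⟩
    have hv0 : v = 0 := by
      refine P.eq_zero_of_mem_rootSpan_of_rootForm_self_eq_zero ?_ ?_
      · exact Submodule.sub_mem _ (Submodule.smul_mem _ _ (hmem i))
          (Submodule.smul_mem _ _ (hmem j))
      · rw [hvv, heq, sub_self, mul_zero]
    rw [← natCast_zsmul, ← natCast_zsmul _ p.toNat, Int.toNat_of_nonneg (by omega),
      Int.toNat_of_nonneg hp.le]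
    calc -r • P.root i + p • P.root j = -v := by rw [hvdef, neg_smul]; abel
      _ = 0 := by rw [hv0, neg_zero]

end Coweight

/-! ### Root homomorphisms: conjugation of ordered products, commutators as ordered products -/

section RootHoms

variable {k : Type*} [Field k] {n : Type*} [Fintype n] [DecidableEq n]
variable {ι X Y : Type*} [AddCommGroup X]
variable {G T : Subgroup (GL n k)}

/-- `χ_{a • x} = χ_x ^ a` for `a : ℕ` (companion to `charOfWeight_add'`, `charOfWeight_zsmul`).
[folklore] -/
lemma charOfWeight_nsmul (eX : Additive ↥(characterLattice T) ≃+ X) (a : ℕ) (x : X) :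
    charOfWeight eX (a • x) = charOfWeight eX x ^ a := by
  simp [charOfWeight, toMul_nsmul]

/-- The torus relation of a root homomorphism, in `GL n k`: `t u(x) t⁻¹ = u(α(t) x)`
(Springer 8.1.1 (i)). [folklore] -/
lemma IsRootHom.coe_conj_eq {hTG : T ≤ G} {α : ↥T →* kˣ} {u : Multiplicative k →* ↥G}
    (hu : IsRootHom G T hTG α u) (t : ↥T) (x : k) :
    (t : GL n k) * ((u (Multiplicative.ofAdd x) : ↥G) : GL n k) * (t : GL n k)⁻¹ =
      ((u (Multiplicative.ofAdd ((α t : k) * x)) : ↥G) : GL n k) := by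
  have h := congrArg Subtype.val (hu.2.2 t x)
  simpa only [Subgroup.coe_mul, Subgroup.coe_inv, Subgroup.coe_inclusion] using h

/-- Conjugating an ordered product of root homomorphisms by `t ∈ T` rescales the parameters by
the roots: `t (∏ u_m(z_m)) t⁻¹ = ∏ u_m(α_m(t) z_m)`. [folklore] -/
lemma conj_rootProd {hTG : T ≤ G} {α : ι → ↥T →* kˣ} {u : ι → Multiplicative k →* ↥G}
    (hu : ∀ m, IsRootHom G T hTG (α m) (u m)) (t : ↥T) (l : List ι) (z : ι → k) :
    (t : GL n k) * rootProd u l z * (t : GL n k)⁻¹ = rootProd u l fun m => (α m t : k) * z m := by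
  unfold rootProd
  rw [← MulAut.conj_apply, map_list_prod, List.map_map]
  congr 1
  refine List.map_congr_left fun m _ => ?_
  rw [Function.comp_apply, MulAut.conj_apply, (hu m).coe_conj_eq]

/-- `∏ u_m(0) = 1`. [folklore] -/
lemma rootProd_zero (u : ι → Multiplicative k →* ↥G) (l : List ι) : rootProd u l 0 = 1 := by
  unfold rootProd
  apply List.prod_eq_one
  intro g hg
  rw [List.mem_map] at hg
  obtain ⟨m, -, rfl⟩ := hg
  simp

/-- The commutator `(u_i(a), u_j(b)) = u_i(a) u_j(b) u_i(-a) u_j(-b)` as an ordered product of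
four root homomorphism values with independent parameters. [folklore] -/
lemma commutatorElement_eq_rootProd (u : ι → Multiplicative k →* ↥G) (i j : ι) (a b : k) :
    ⁅((u i (Multiplicative.ofAdd a) : ↥G) : GL n k),
        ((u j (Multiplicative.ofAdd b) : ↥G) : GL n k)⁆ =
      rootProd (fun s : Fin 4 => u (![i, j, i, j] s)) [0, 1, 2, 3] ![a, b, -a, -b] := by
  simp [rootProd, commutatorElement_def, ofAdd_neg, mul_assoc]

/-- A commutator of two elements of a subgroup lies in it. [folklore] -/
lemma commutatorElement_mem_of_mem {H : Subgroup (GL n k)} {g h : GL n k} (hg : g ∈ H)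
    (hh : h ∈ H) : ⁅g, h⁆ ∈ H := by
  rw [commutatorElement_def]
  exact H.mul_mem (H.mul_mem (H.mul_mem hg hh) (H.inv_mem hg)) (H.inv_mem hh)

end RootHoms

/-! ### Springer's proof of 8.2.3 from 8.2.1 -/

section Core

variable {k : Type*} [Field k] {n : Type*} [Fintype n] [DecidableEq n]
variable {ι X Y : Type*} [AddCommGroup X] [AddCommGroup Y]
variable {G T : Subgroup (GL n k)}
variable {P : RootPairing ι ℤ X Y} {eX : Additive ↥(characterLattice T) ≃+ X}

/-- **Springer's proof of the commutator relations 8.2.3 from the product structure 8.2.1**, in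
any characteristic. Let `T ≤ G ≤ GL_n` over an infinite field, `P` a root pairing with root
homomorphisms `u_m` for the characters `α_m = χ_{P.root m}` of `T`, `y` a coweight and `l` a list
of indices such that the product map `x ↦ ∏_{m ∈ l} u_m(x_m)` maps onto
`U(y) = ⟨u_m(𝔾ₐ) : ⟨α_m, y⟩ > 0⟩` (`hsurj`) and has a polynomial left inverse `(q_m)_{m ∈ l}`
(`hq`) — the two halves of Springer 8.2.1 for the positive system `R⁺(y)`. Then for `y`-positive
roots `α_i, α_j` the commutator `(u_i(a), u_j(b))` lies in the group generated by the root
subgroups `U_{α_m}` with `α_m = c α_i + d α_j`, `c, d > 0`. Printed argument (8.2.3, proof):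
`(u_i(a), u_j(b)) = ∏_m u_m(P_m(a, b))` with polynomials `P_m = q_m ∘ (u_i(a), u_j(b))`;
conjugating by `t ∈ T` (and comparing the two product expressions through `q_m`) gives
`P_m(α_i(t) a, α_j(t) b) = α_m(t) P_m(a, b)`, so every monomial `aᶜ bᵈ` of `P_m` has
`α_iᶜ α_jᵈ = α_m` (compare coefficients, `coeff_bind₁_C_mul_X`), i.e. `α_m = c α_i + d α_j` in
`X`; and `d = 0` (or `c = 0`) is impossible since `P_m(a, 0) = q_m(1) = 0` — putting `b = 0` the
commutator is `1`. [cite: SpringerLAG1998, Prop 8.2.3 (proof)] -/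
theorem commutatorElement_mem_iSup_rootSubgroup_of_range_rootProd [Infinite k] {hTG : T ≤ G}
    (u : ι → Multiplicative k →* ↥G)
    (hu : ∀ m, IsRootHom G T hTG (charOfWeight eX (P.root m)) (u m)) (y : Y) (l : List ι)
    (hq : ∃ q : ι → MvPolynomial (GLCoord n) k, ∀ (x : ι → k), ∀ m ∈ l,
      MvPolynomial.eval (glCoordFun (rootProd u l x)) (q m) = x m)
    (hsurj : (posRootGroup G P u y : Set (GL n k)) ⊆ Set.range (rootProd u l))
    {i j : ι} (hi : 0 < P.root' i y) (hj : 0 < P.root' j y) (a b : k) :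
    ⁅((u i (Multiplicative.ofAdd a) : ↥G) : GL n k),
        ((u j (Multiplicative.ofAdd b) : ↥G) : GL n k)⁆ ∈
      ⨆ (m : ι) (_ : ∃ c d : ℕ, 0 < c ∧ 0 < d ∧ P.root m = c • P.root i + d • P.root j),
        rootSubgroup G T (charOfWeight eX (P.root m)) := by
  classical
  -- notation: the roots `χ m`, the commutator map `comm`, its coordinates `zf`
  set χ : ι → (↥T →* kˣ) := fun m => charOfWeight eX (P.root m) with hχ
  obtain ⟨comm, hcomm⟩ : ∃ comm : k → k → GL n k, ∀ a b, comm a b =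
      ⁅((u i (Multiplicative.ofAdd a) : ↥G) : GL n k),
        ((u j (Multiplicative.ofAdd b) : ↥G) : GL n k)⁆ := ⟨_, fun _ _ => rfl⟩
  obtain ⟨q, hq⟩ := hq
  obtain ⟨zf, hzf⟩ : ∃ zf : k → k → ι → k, ∀ a b m,
      zf a b m = MvPolynomial.eval (glCoordFun (comm a b)) (q m) := ⟨_, fun _ _ _ => rfl⟩
  -- (1) the commutator lies in `U(y)`, hence is the ordered product with parameters `zf a b`
  have hmemU : ∀ a b, comm a b ∈ posRootGroup G P u y := fun a b => by
    rw [hcomm]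
    exact commutatorElement_mem_of_mem (apply_mem_posRootGroup u hi _)
      (apply_mem_posRootGroup u hj _)
  have hE1 : ∀ a b, comm a b = rootProd u l (zf a b) := by
    intro a b
    obtain ⟨z, hz⟩ := hsurj (hmemU a b)
    have hzf' : zf a b = fun m => MvPolynomial.eval (glCoordFun (comm a b)) (q m) :=
      funext (hzf a b)
    rw [hzf', ← hz]
    exact rootProd_congr u l fun m hm => (hq z m hm).symm
  -- (2) `T`-equivariance: `zf (α_i(t) a) (α_j(t) b) m = α_m(t) zf a b m` for `m ∈ l`
  have hE2 : ∀ (t : ↥T) (a b : k), ∀ m ∈ l,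
      zf ((χ i t : k) * a) ((χ j t : k) * b) m = (χ m t : k) * zf a b m := by
    intro t a b m hm
    have h1 : comm ((χ i t : k) * a) ((χ j t : k) * b) =
        (t : GL n k) * comm a b * (t : GL n k)⁻¹ := by
      rw [hcomm, hcomm, ← (hu i).coe_conj_eq t a, ← (hu j).coe_conj_eq t b]
      simp only [commutatorElement_def]
      group
    have h2 : (t : GL n k) * comm a b * (t : GL n k)⁻¹ =
        rootProd u l (fun m => (χ m t : k) * zf a b m) := by
      rw [hE1 a b, conj_rootProd hu]
    have h3 := hq (fun m => (χ m t : k) * zf a b m) m hm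
    rw [← h2, ← h1] at h3
    rw [hzf]
    exact h3
  -- (3) `zf a b m` is a polynomial `Z m` in `(a, b)`: the coordinates of the commutator, an
  -- ordered product of four root homomorphism values, are polynomials (`eval_rootProdHom`)
  obtain ⟨Z, hZ⟩ : ∃ Z : ι → MvPolynomial (Fin 2) k, ∀ (v : Fin 2 → k) (m : ι),
      MvPolynomial.eval v (Z m) = zf (v 0) (v 1) m := by
    choose Pu hPu using fun m => (hu m).1
    refine ⟨fun m => bind₁
      ![MvPolynomial.X 0, MvPolynomial.X 1, -MvPolynomial.X 0, -MvPolynomial.X 1]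
      (rootProdHom (fun s : Fin 4 => Pu (![i, j, i, j] s)) [0, 1, 2, 3] (q m)), fun v m => ?_⟩
    have hσ : (fun s : Fin 4 => MvPolynomial.eval v
        ((![MvPolynomial.X 0, MvPolynomial.X 1, -MvPolynomial.X 0, -MvPolynomial.X 1] :
          Fin 4 → MvPolynomial (Fin 2) k) s)) = ![v 0, v 1, -v 0, -v 1] := by
      funext s
      fin_cases s <;> simp
    rw [eval_bind₁, hσ, eval_rootProdHom (u := fun s : Fin 4 => u (![i, j, i, j] s))
      (fun s x c => hPu _ x c), ← commutatorElement_eq_rootProd, hzf, hcomm]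
  -- `zf a 0 m = 0 = zf 0 b m` for `m ∈ l`: the commutator with `1` is `1`, and `q_m(1) = 0`
  have hq1 : ∀ m ∈ l, MvPolynomial.eval (glCoordFun (1 : GL n k)) (q m) = 0 := by
    intro m hm
    have := hq 0 m hm
    rwa [rootProd_zero] at this
  have hzero_b : ∀ a, ∀ m ∈ l, zf a 0 m = 0 := by
    intro a m hm
    rw [hzf, hcomm]
    simpa using hq1 m hm
  have hzero_a : ∀ b, ∀ m ∈ l, zf 0 b m = 0 := by
    intro b m hm
    rw [hzf, hcomm]
    simpa using hq1 m hm
  -- (4) the monomials `aᶜ bᵈ` of `Z m`: `c, d > 0` and `α_m = c α_i + d α_j`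
  have hcoef : ∀ m ∈ l, ∀ d : Fin 2 →₀ ℕ, coeff d (Z m) ≠ 0 →
      0 < d 0 ∧ 0 < d 1 ∧ P.root m = d 0 • P.root i + d 1 • P.root j := by
    intro m hm d hd
    -- a functional equation `zf (w₀ a) (w₁ b) m = c · zf a b m` forces `w₀^{d 0} w₁^{d 1} = c`
    have hscale : ∀ (w : Fin 2 → k) (c : k), (∀ a b, zf (w 0 * a) (w 1 * b) m = c * zf a b m) →
        w 0 ^ d 0 * w 1 ^ d 1 = c := by
      intro w c hw
      have hpoly : bind₁ (fun s => C (w s) * MvPolynomial.X s) (Z m) = C c * Z m := by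
        apply MvPolynomial.funext
        intro v
        rw [eval_bind₁_C_mul_X, hZ, map_mul, eval_C, hZ]
        exact hw (v 0) (v 1)
      have hc := congrArg (coeff d) hpoly
      rw [coeff_bind₁_C_mul_X, coeff_C_mul, Finsupp.prod_fintype _ _ (fun _ => pow_zero _),
        Fin.prod_univ_two] at hc
      exact mul_right_cancel₀ hd hc
    have hd1 : 0 < d 1 := by
      rw [Nat.pos_iff_ne_zero]
      intro h0
      have := hscale ![1, 0] 0 (fun a b => by simpa using hzero_b a m hm)
      simp [h0] at this
    have hd0 : 0 < d 0 := by
      rw [Nat.pos_iff_ne_zero]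
      intro h0
      have := hscale ![0, 1] 0 (fun a b => by simpa using hzero_a b m hm)
      simp [h0] at this
    refine ⟨hd0, hd1, charOfWeight_injective eX ?_⟩
    rw [charOfWeight_add', charOfWeight_nsmul, charOfWeight_nsmul]
    ext t
    have hw := hscale ![(χ i t : k), (χ j t : k)] (χ m t : k) (fun a b => hE2 t a b m hm)
    simp only [Matrix.cons_val_zero, Matrix.cons_val_one] at hw
    simp only [hχ] at hw
    simp only [MonoidHom.mul_apply, MonoidHom.pow_apply, Units.val_mul, Units.val_pow_eq_pow_val]
    exact hw.symm
  -- (5) conclusion: every factor `u_m(zf a b m)` of the commutator lies in the join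
  rw [← hcomm, hE1 a b]
  unfold rootProd
  refine Subgroup.list_prod_mem _ ?_
  intro g hg
  rw [List.mem_map] at hg
  obtain ⟨m, hm, rfl⟩ := hg
  by_cases hZm : Z m = 0
  · have h0 : zf a b m = 0 := by
      have := hZ ![a, b] m
      simpa [hZm] using this.symm
    rw [h0]
    simp
  · obtain ⟨d, hd⟩ := MvPolynomial.ne_zero_iff.mp hZm
    obtain ⟨hd0, hd1, hroot⟩ := hcoef m hm d hd
    refine Subgroup.mem_iSup_of_mem m (Subgroup.mem_iSup_of_mem ⟨d 0, d 1, hd0, hd1, hroot⟩ ?_)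
    exact (hu m).map_range_le_rootSubgroup ⟨_, ⟨_, rfl⟩, rfl⟩

variable [IsMulCommutative ↥T] {eY : Additive ↥(cocharacterLattice T) ≃+ Y}

/-- **The commutator relations for the root subgroups from 8.2.1 and 8.1.1 (i)**, in any
characteristic: for `G` connected reductive over an algebraically closed field, `T` a maximal
torus with root datum `P` and root homomorphisms `u_m`, a coweight `y` for which both halves of
8.2.1 hold for `U(y)` (`hq`, `hsurj`, as in
`commutatorElement_mem_iSup_rootSubgroup_of_range_rootProd`), and `y`-positive roots
`α_i, α_j`, one has `(U_{α_i}, U_{α_j}) ≤ ⟨U_{α_m} : α_m = c α_i + d α_j, c, d > 0⟩`, granted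
`rootSubgroup_unique` (8.1.1 (i): `U_{α_m} = u_m(𝔾ₐ)`).
[cite: SpringerLAG1998, Prop 8.2.3 (proof)] -/
theorem commutator_rootSubgroup_le_of_range_rootProd [IsAlgClosed k]
    (hU : rootSubgroup_unique (G := G) (T := T)) (hG : IsConnectedReductive G)
    (hT : IsMaximalTorusIn T G) (h : IsRootDatumOf G T P eX eY)
    (u : ι → Multiplicative k →* ↥G)
    (hu : ∀ m, IsRootHom G T h.le (charOfWeight eX (P.root m)) (u m)) (y : Y) (l : List ι)
    (hq : ∃ q : ι → MvPolynomial (GLCoord n) k, ∀ (x : ι → k), ∀ m ∈ l,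
      MvPolynomial.eval (glCoordFun (rootProd u l x)) (q m) = x m)
    (hsurj : (posRootGroup G P u y : Set (GL n k)) ⊆ Set.range (rootProd u l))
    {i j : ι} (hi : 0 < P.root' i y) (hj : 0 < P.root' j y) :
    ⁅rootSubgroup G T (charOfWeight eX (P.root i)),
        rootSubgroup G T (charOfWeight eX (P.root j))⁆ ≤
      ⨆ (m : ι) (_ : ∃ c d : ℕ, 0 < c ∧ 0 < d ∧ P.root m = c • P.root i + d • P.root j),
        rootSubgroup G T (charOfWeight eX (P.root m)) := by
  -- `U_{α_m} = u_m(𝔾ₐ)` by 8.1.1 (i)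
  have hUeq : ∀ m, rootSubgroup G T (charOfWeight eX (P.root m)) = (u m).range.map G.subtype := by
    intro m
    obtain ⟨α, hα, hαm⟩ := h.exists_root_eq m
    have key := hU hG hT hα (u := u m) (by rw [hαm]; exact hu m)
    rw [hαm] at key
    exact key.symm
  rw [hUeq i, hUeq j, Subgroup.commutator_le]
  rintro _ ⟨_, ⟨a, rfl⟩, rfl⟩ _ ⟨_, ⟨b, rfl⟩, rfl⟩
  have := commutatorElement_mem_iSup_rootSubgroup_of_range_rootProd u hu y l hq hsurj hi hj
    a.toAdd b.toAdd
  simpa using this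

end Core

/-! ### Springer 8.2.3 in characteristic `0` from 8.1.1 (i) -/

section Main

variable {k : Type*} [Field k] {n : Type*} [Fintype n] [DecidableEq n]
variable {ι X Y : Type*} [AddCommGroup X] [AddCommGroup Y]
variable {G T : Subgroup (GL n k)} [IsMulCommutative ↥T]

/-- **Springer 8.2.3 (the commutator relations, corollary form) in characteristic `0`, granted
8.1.1 (i).** For `G` connected reductive over an algebraically closed field of characteristic `0`,
`T` a maximal torus with root datum `P` and roots `α_i ≠ ±α_j`, the commutator group
`(U_{α_i}, U_{α_j})` lies in the subgroup generated by the `U_{c α_i + d α_j}`, `c, d > 0` — the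
named fact `rootSubgroup_commutator_le` of `RootSubgroupCommutators.lean` — granted the uniqueness
of root subgroups `rootSubgroup_unique` (8.1.1 (i): `U_α = u_α(𝔾ₐ)`, whence `dim 𝔤_α ≤ 1`).
Proof: choose a coweight `y` positive on `α_i` and `α_j`
(`RootPairing.exists_root'_pos_and_root'_pos_or`; in the degenerate case `s α_i + t α_j = 0`,
`s, t > 0`, both `U_{α_i}` and `U_{α_j}` are among the generators and `(H, K) ≤ H ⊔ K`); both
halves of 8.2.1 hold for `U(y)` in characteristic `0` (`exists_polyRetraction_prod_rootHom`, and
`posRootGroup_subset_range_rootProd` with `finrank_lieWeightSpace_le_one_of_rootSubgroup_unique`);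
conclude by `commutator_rootSubgroup_le_of_range_rootProd` (Springer's argument). The hypotheses
`α_i ≠ ±α_j` of the fact are not needed for the corollary form. Combined with
`rootSubgroup_unique_of_facts₃` (`RootSubgroupAssembly.lean`), in characteristic `0` the fact
reduces to Springer 7.6.4 (i) and 7.3.3 (ii). [cite: SpringerLAG1998, Prop 8.2.3] -/
theorem rootSubgroup_commutator_le_of_rootSubgroup_unique [CharZero k]
    (hU : rootSubgroup_unique (G := G) (T := T)) :
    rootSubgroup_commutator_le (G := G) (T := T) (ι := ι) (X := X) (Y := Y) := by
  intro _ hG hT P eX eY h i j _ _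
  classical
  haveI : Finite ι := h.finite_index hG hT
  letI : Fintype ι := Fintype.ofFinite ι
  rcases P.exists_root'_pos_and_root'_pos_or i j with ⟨y, hyi, hyj⟩ | ⟨s, t, hs, ht, hst⟩
  · -- root homomorphisms, a numbering of the `y`-positive roots, and 8.2.1 for `U(y)`
    set u : ι → Multiplicative k →* ↥G := fun m =>
      (h.exists_sl2Hom m).choose.comp unipotentUpperSL2 with hudef
    have hu : ∀ m, IsRootHom G T h.le (charOfWeight eX (P.root m)) (u m) := fun m =>
      (h.exists_sl2Hom m).choose_spec.2.1
    set l : List ι := (Finset.univ.filter fun m => 0 < P.root' m y).toList with hl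
    have hln : l.Nodup := Finset.nodup_toList _
    have hl' : ∀ m, m ∈ l ↔ 0 < P.root' m y := fun m => by simp [hl]
    have hdim : ∀ m, Module.finrank k ↥(lieWeightSpace G T (charOfWeight eX (P.root m))) ≤ 1 := by
      intro m
      obtain ⟨α, hα, hαm⟩ := h.exists_root_eq m
      rw [← hαm]
      exact finrank_lieWeightSpace_le_one_of_rootSubgroup_unique hU hG hT hα
    exact commutator_rootSubgroup_le_of_range_rootProd hU hG hT h u hu y l
      (exists_polyRetraction_prod_rootHom hT.2.1 h u hu y l hln fun m hm => (hl' m).mp hm)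
      (posRootGroup_subset_range_rootProd hG.1.1 hT.2.1 h u hu y l hln hl' hdim) hyi hyj
  · -- degenerate case: `U_{α_i}` and `U_{α_j}` are among the generators
    refine (Subgroup.commutator_le_sup _ _).trans (sup_le ?_ ?_)
    · refine le_iSup₂_of_le i ⟨s + 1, t, Nat.succ_pos s, ht, ?_⟩ le_rfl
      rw [add_smul, one_smul, add_comm (s • P.root i), add_assoc, hst, add_zero]
    · refine le_iSup₂_of_le j ⟨s, t + 1, hs, Nat.succ_pos t, ?_⟩ le_rfl
      rw [add_smul, one_smul, ← add_assoc, hst, zero_add]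

end Main

/-!
## Part II. Every characteristic: both halves of 8.2.1 for `U(y)`, and 8.2.3, granted Springer 8.1.2
-/

/-! ### The polynomial left inverse of `x ↦ ∏ u_m(x_m)` without characteristic `0` -/

section RetractionCharFree

open _root_.Polynomial

variable {k : Type*} [Field k] {n : Type*} [Fintype n] [DecidableEq n]
variable {ι X Y : Type*} [AddCommGroup X] [AddCommGroup Y]
variable {G T : Subgroup (GL n k)}

/-- **The entries of a conjugate `A u(x) A⁻¹` of a root homomorphism have a non-zero linear term**
(any characteristic). If every entry of `A u(x) A⁻¹`, as a polynomial in `x`, had vanishing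
`X¹`-coefficient, so would every coordinate of `u(x) = A⁻¹ (A u(x) A⁻¹) A` (the coordinate
`det⁻¹` is the constant `1`), hence so would the polynomial retraction `q ∘ u = X` of `IsRootHom` —
absurd. This is the velocity `du(d/dx) ≠ 0` of Springer 8.1.1 (i) (`u_α` is an isomorphism onto
its image), cf. `IsRootHom.exists_weightVector`. [cite: SpringerLAG1998, 8.1.1 (i)] -/
theorem IsRootHom.exists_coeff_one_ne_zero_of_conj [Infinite k] {hTG : T ≤ G} {α : ↥T →* kˣ}
    {u : Multiplicative k →* ↥G} (hu : IsRootHom G T hTG α u) (A : GL n k) {Pc : n → n → k[X]}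
    (hPc : ∀ (x : k) (p q : n),
      ((A * ((u (Multiplicative.ofAdd x) : ↥G) : GL n k) * A⁻¹ : GL n k) : Matrix n n k) p q =
        (Pc p q).eval x) :
    ∃ pq : n × n, (Pc pq.1 pq.2).coeff 1 ≠ 0 := by
  by_contra hall
  have hlin : ∀ p q, (Pc p q).coeff 1 = 0 := fun p q => by
    by_contra hne
    exact hall ⟨⟨p, q⟩, hne⟩
  obtain ⟨qr, hqr⟩ := hu.2.1
  -- coordinate polynomials of `u x` itself
  let P' : GLCoord n → k[X] := fun c => match c with
    | Sum.inl ab => ∑ q, ∑ p, Polynomial.C (((A⁻¹ : GL n k) : Matrix n n k) ab.1 p) * Pc p q *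
        Polynomial.C ((A : Matrix n n k) q ab.2)
    | Sum.inr _ => 1
  have hP' : ∀ (x : k) (c : GLCoord n),
      glCoordFun ((u (Multiplicative.ofAdd x) : ↥G) : GL n k) c = (P' c).eval x := by
    intro x c
    rcases c with ⟨a, b⟩ | uu
    · rw [glCoordFun_inl]
      have hg : ((u (Multiplicative.ofAdd x) : ↥G) : GL n k) =
          A⁻¹ * (A * ((u (Multiplicative.ofAdd x) : ↥G) : GL n k) * A⁻¹) * A := by group
      have hm : (((u (Multiplicative.ofAdd x) : ↥G) : GL n k) : Matrix n n k) a b =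
          (((A⁻¹ : GL n k) : Matrix n n k) *
            ((A * ((u (Multiplicative.ofAdd x) : ↥G) : GL n k) * A⁻¹ : GL n k) : Matrix n n k) *
            (A : Matrix n n k)) a b := by
        conv_lhs => rw [hg]
        simp only [Units.val_mul]
      rw [hm]
      simp only [Matrix.mul_apply, hPc, Polynomial.eval_finsetSum, Polynomial.eval_mul,
        Polynomial.eval_C, Finset.sum_mul, P']
    · rw [glCoordFun_inr, hu.1.det_eq_one x, inv_one]
      simp [P']
  have hcoeff : ∀ c, (P' c).coeff 1 = 0 := by
    rintro (⟨a, b⟩ | uu)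
    · simp only [P', Polynomial.finsetSum_coeff, Polynomial.coeff_mul_C, Polynomial.coeff_C_mul,
        hlin, mul_zero, zero_mul, Finset.sum_const_zero]
    · change Polynomial.coeff (1 : k[X]) 1 = 0
      rw [Polynomial.coeff_one]
      exact if_neg one_ne_zero
  -- substituting the coordinates into the retraction gives the polynomial `X`
  have hQ : MvPolynomial.eval₂ Polynomial.C P' qr = Polynomial.X := by
    apply Polynomial.funext
    intro x
    rw [eval_mvPolynomialEval₂_C, Polynomial.eval_X]
    have hglc : glCoordFun ((u (Multiplicative.ofAdd x) : ↥G) : GL n k) = fun c => (P' c).eval x :=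
      funext (hP' x)
    rw [← hglc]
    exact hqr x
  have h01 := coeff_one_mvPolynomialEval₂_C_eq_zero P' hcoeff qr
  rw [hQ, Polynomial.coeff_X_one] at h01
  exact one_ne_zero h01

variable [IsMulCommutative ↥T]

/-- **The polynomial left inverse of an ordered product of root homomorphisms, in every
characteristic** (the injectivity half of Springer 8.2.1 in coordinates; the characteristic-free
form of `exists_polyRetraction_prod_rootHom` of `RootProductRetraction.lean`). Let `T ≤ G ≤ GL_n`
with `T` a torus over an algebraically closed field, `P` a root datum of `(G, T)` with root
homomorphisms `u_i`, and `(α_i)_{i ∈ l}` distinct roots all positive on a coweight `y`. Then there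
are polynomials `q_i` in the matrix coordinates with `q_i(∏_{j ∈ l} u_j(x_j)) = x_i` for all `x`
and `i ∈ l`. The proof is that of `exists_polyRetraction_prod_rootHom` (diagonalise `T` by `A`;
the `X^d`-coefficients of the entries of `A u_i(x) A⁻¹` have `T`-weight `α_i^d`; conclude by
`exists_mvPolynomial_retraction` with the height `⟨·, y⟩`) except for the non-vanishing of the
linear terms, which there used characteristic `0` and here comes from the polynomial retraction
in `IsRootHom` (`IsRootHom.exists_coeff_one_ne_zero_of_conj`: `u_i` is an isomorphism onto its
image, Springer 8.1.1 (i)). [cite: SpringerLAG1998, Prop. 8.2.1] -/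
theorem exists_polyRetraction_prod_rootHom' [IsAlgClosed k] (hT : IsTorusSubgroup T)
    {P : RootPairing ι ℤ X Y} {eX : Additive ↥(characterLattice T) ≃+ X}
    {eY : Additive ↥(cocharacterLattice T) ≃+ Y} (h : IsRootDatumOf G T P eX eY)
    (u : ι → Multiplicative k →* ↥G)
    (hu : ∀ i, IsRootHom G T h.le (charOfWeight eX (P.root i)) (u i))
    (y : Y) (l : List ι) (hl : l.Nodup) (hl' : ∀ i ∈ l, 0 < P.root' i y) :
    ∃ q : ι → MvPolynomial (GLCoord n) k, ∀ (x : ι → k), ∀ i ∈ l,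
      MvPolynomial.eval (glCoordFun
        (l.map fun i => ((u i (Multiplicative.ofAdd (x i)) : ↥G) : GL n k)).prod) (q i) = x i := by
  classical
  obtain ⟨A, hA⟩ := exists_conj_le_diagonalSubgroup hT.2.1 hT.2.2
  have hA' : T.map (MulAut.conj A : GL n k →* GL n k) ≤ diagonalSubgroup n k := hA
  set γ : kˣ →* ↥T := cocharOfCoweight eY y with hγdef
  have hγ : IsAlgebraicCochar γ := (Additive.toMul (eY.symm y)).2
  have halg : ∀ i, IsAlgebraicChar (charOfWeight eX (P.root i)) := fun i =>
    (Additive.toMul (eX.symm (P.root i))).2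
  have hpair : ∀ i, charPairingInt (charOfWeight eX (P.root i)) γ = P.root' i y := by
    intro i
    have e := h.pairing_eq (Additive.toMul (eX.symm (P.root i))) (Additive.toMul (eY.symm y))
    simp only [ofMul_toMul, AddEquiv.apply_symm_apply] at e
    exact e.symm
  -- polynomial entries of the conjugated root homomorphisms
  choose Pc hPc using fun i => (hu i).1.exists_polynomial_conj A
  -- the coordinate characters, the weights and the height
  set χ : n → ↥(characterLattice T) := fun p =>
    ⟨(diagEntryChar hA' p).comp (conjEquiv A T).toMonoidHom,
      (isAlgebraicChar_diagEntryChar hA' p).comp_conjEquiv A⟩ with hχ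
  set e : n → Additive ↥(characterLattice T) := fun p => Additive.ofMul (χ p) with he
  set w : ι → Additive ↥(characterLattice T) := fun i => eX.symm (P.root i) with hw
  let hgt : Additive ↥(characterLattice T) →+ ℤ :=
    { toFun := fun c => charPairingInt ((Additive.toMul c : ↥(characterLattice T)) : ↥T →* kˣ) γ
      map_zero' := charPairingInt_one_left hγ
      map_add' := fun c c' =>
        charPairingInt_mul_left (Additive.toMul c).2 (Additive.toMul c').2 hγ }
  -- torus relation, conjugated: weights of the coefficients
  have hconj : ∀ (i : ι) (t : ↥T) (x : k) (p q : n),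
      ((χ p : ↥T →* kˣ) t : k) * (Pc i p q).eval x * (((χ q : ↥T →* kˣ) t : k))⁻¹ =
        (Pc i p q).eval (((charOfWeight eX (P.root i) t : kˣ) : k) * x) := by
    intro i t x p q
    have key : (A * ((t : ↥T) : GL n k) * A⁻¹) *
        (A * ((u i (Multiplicative.ofAdd x) : ↥G) : GL n k) * A⁻¹) *
        (A * ((t⁻¹ : ↥T) : GL n k) * A⁻¹) =
          A * ((u i (Multiplicative.ofAdd (((charOfWeight eX (P.root i) t : kˣ) : k) * x)) : ↥G) :
            GL n k) * A⁻¹ := by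
      have h3 := congrArg (fun g : ↥G => (g : GL n k)) ((hu i).2.2 t x)
      simp only [Subgroup.coe_mul, Subgroup.coe_inv, Subgroup.coe_inclusion] at h3
      rw [← h3, Subgroup.coe_inv]
      group
    have kmat : ((A * ((t : ↥T) : GL n k) * A⁻¹ : GL n k) : Matrix n n k) *
        ((A * ((u i (Multiplicative.ofAdd x) : ↥G) : GL n k) * A⁻¹ : GL n k) : Matrix n n k) *
        ((A * ((t⁻¹ : ↥T) : GL n k) * A⁻¹ : GL n k) : Matrix n n k) =
          ((A * ((u i (Multiplicative.ofAdd (((charOfWeight eX (P.root i) t : kˣ) : k) * x)) :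
            ↥G) : GL n k) * A⁻¹ : GL n k) : Matrix n n k) := by
      rw [← Units.val_mul, ← Units.val_mul, key]
    rw [conj_torus_eq_diagonal A hA' t, conj_torus_inv_eq_diagonal A hA' t] at kmat
    have kij := congr_fun (congr_fun kmat p) q
    rw [Matrix.mul_diagonal, Matrix.diagonal_mul, hPc, hPc] at kij
    exact kij
  have hwt : ∀ i ∈ l, ∀ p q d, (Pc i p q).coeff d ≠ 0 → d • w i = e p - e q := by
    intro i _ p q d hd
    -- `(α_i t)^d = χ_p t / χ_q t` for all `t`
    have hpow : ∀ t : ↥T, ((charOfWeight eX (P.root i) t : kˣ) : k) ^ d =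
        ((χ p : ↥T →* kˣ) t : k) * (((χ q : ↥T →* kˣ) t : k))⁻¹ := fun t =>
      pow_eq_of_eval_mul_eq (Pc i p q) (fun x => by
        rw [← hconj i t x p q]; ring) hd
    -- as an identity in the character lattice
    have hmul : (Additive.toMul (w i)) ^ d = χ p * (χ q)⁻¹ := by
      apply Subtype.ext
      ext t
      have h1 : (((Additive.toMul (w i) ^ d : ↥(characterLattice T)) : ↥T →* kˣ) t : k) =
          ((charOfWeight eX (P.root i) t : kˣ) : k) ^ d := by
        rw [SubmonoidClass.coe_pow, MonoidHom.pow_apply, Units.val_pow_eq_pow_val]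
        rfl
      rw [h1, hpow t, Subgroup.coe_mul, Subgroup.coe_inv, MonoidHom.mul_apply,
        MonoidHom.inv_apply, Units.val_mul, Units.val_inv_eq_inv_val]
    have : d • w i = Additive.ofMul (χ p * (χ q)⁻¹) := by
      rw [← hmul]; rfl
    rw [this, ofMul_mul, ofMul_inv, he, sub_eq_add_neg]
  have h0 : ∀ i ∈ l, ∀ p q, (Pc i p q).coeff 0 = (1 : Matrix n n k) p q := by
    intro i _ p q
    rw [Polynomial.coeff_zero_eq_eval_zero, ← hPc]
    simp
  -- the linear terms are non-zero (the retraction clause of `IsRootHom`)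
  have h1 : ∀ i ∈ l, ∃ pq : n × n, (Pc i pq.1 pq.2).coeff 1 ≠ 0 := fun i _ =>
    (hu i).exists_coeff_one_ne_zero_of_conj A (hPc i)
  have hinj : ∀ i ∈ l, ∀ i' ∈ l, w i = w i' → i = i' := by
    intro i _ i' _ hii'
    exact P.root.injective (eX.symm.injective hii')
  have hpos : ∀ i ∈ l, 0 < hgt (w i) := by
    intro i hi
    change 0 < charPairingInt ((Additive.toMul (eX.symm (P.root i)) : ↥(characterLattice T)) :
      ↥T →* kˣ) γ
    rw [show ((Additive.toMul (eX.symm (P.root i)) : ↥(characterLattice T)) : ↥T →* kˣ) =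
      charOfWeight eX (P.root i) from rfl, hpair]
    exact hl' i hi
  -- the abstract retraction
  obtain ⟨Q, hQ⟩ := exists_mvPolynomial_retraction Pc l hl w e hwt h0 h1 hinj hgt hpos
  -- the product, conjugated by `A`, is `prodMat Pc l x`
  have hprod : ∀ x : ι → k, prodMat Pc l x =
      ((A * (l.map fun i => ((u i (Multiplicative.ofAdd (x i)) : ↥G) : GL n k)).prod * A⁻¹ :
        GL n k) : Matrix n n k) := by
    intro x
    have hc : A * (l.map fun i => ((u i (Multiplicative.ofAdd (x i)) : ↥G) : GL n k)).prod * A⁻¹ =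
        (l.map fun i => A * ((u i (Multiplicative.ofAdd (x i)) : ↥G) : GL n k) * A⁻¹).prod := by
      have := map_list_prod (MulAut.conj A).toMonoidHom
        (l.map fun i => ((u i (Multiplicative.ofAdd (x i)) : ↥G) : GL n k))
      rw [List.map_map] at this
      exact this
    rw [hc, ← Units.coeHom_apply, map_list_prod, List.map_map, prodMat]
    congr 1
    refine List.map_congr_left fun i _ => ?_
    ext p q
    simp only [Function.comp_apply, Matrix.of_apply, Units.coeHom_apply]
    rw [hPc]
  refine ⟨fun j => MvPolynomial.bind₁ (fun pq : n × n => conjPolyGL A A⁻¹ (Sum.inl pq)) (Q j),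
    fun x i hi => ?_⟩
  rw [eval_bind₁]
  have : (fun pq : n × n => MvPolynomial.eval (glCoordFun
      (l.map fun i => ((u i (Multiplicative.ofAdd (x i)) : ↥G) : GL n k)).prod)
        (conjPolyGL A A⁻¹ (Sum.inl pq))) = fun pq : n × n => prodMat Pc l x pq.1 pq.2 := by
    funext pq
    rw [eval_conjPolyGL, glCoordFun_inl, hprod]
  rw [this]
  exact hQ i hi x

end RetractionCharFree

/-! ### Springer 8.2.1 for `U(y)` in every characteristic, granted `P ⊆ R` and `dim 𝔤_α ≤ 1` -/

section SurjectivityCharFree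

variable {k : Type*} [Field k] {n : Type*} [Fintype n] [DecidableEq n]
variable {ι X Y : Type*} [AddCommGroup X] [AddCommGroup Y]
variable {G T : Subgroup (GL n k)} [IsMulCommutative ↥T]
variable {P : RootPairing ι ℤ X Y} {eX : Additive ↥(characterLattice T) ≃+ X}
  {eY : Additive ↥(cocharacterLattice T) ≃+ Y}

/-- **The Lie algebra of `U(y)` lies in the sum of the root spaces of the `y`-positive roots,
granted `P ⊆ R`** (every characteristic; the characteristic-free form of
`lieAlgebraGL_posRootGroup_le` of `PosRootGroupDimension.lean`, whose only use of characteristic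
`0` — the inclusion `P ⊆ R` of the non-zero weights of `T` in `Lie(G)` in the roots,
`lieWeights_subset_roots`, by exponentials — is turned into the hypothesis `hPR`, i.e. the first
clause of Springer 8.1.2, `lieWeights_eq_roots`). Let `G ≤ GL n k` over an algebraically closed
field, `T ≤ G` a torus with `P(G, T) ⊆ R(G, T)`, `P` a root datum of `(G, T)` with root
homomorphisms `u_i` and `y` a coweight; then `Lie(U(y)) ⊆ ⨁_{⟨α_i, y⟩ > 0} 𝔤_{α_i}` for
`U(y) = ⟨u_i(𝔾ₐ) : ⟨α_i, y⟩ > 0⟩`. Proof as there: `Lie(U(y))` is `Ad(T)`-stable, a non-zero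
weight component has an algebraic weight `χ`; in a frame diagonalising `T`, `U(y)` is block upper
unipotent for the weights of `λ_y`, whence `⟨χ, y⟩ > 0`, so `χ ∈ P ⊆ R` is a `y`-positive root.
[cite: SpringerLAG1998, 8.2.1 and 8.1.3 (i), with Cor. 8.1.2] -/
theorem lieAlgebraGL_posRootGroup_le_of_subset [IsAlgClosed k]
    (hPR : lieWeights G T ⊆ roots G T) (hT : IsTorusSubgroup T) (h : IsRootDatumOf G T P eX eY)
    (u : ι → Multiplicative k →* ↥G)
    (hu : ∀ i, IsRootHom G T h.le (charOfWeight eX (P.root i)) (u i)) (y : Y) :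
    lieAlgebraGL (posRootGroup G P u y) ≤
      ⨆ i : {i : ι // 0 < P.root' i y}, lieWeightSpace G T (charOfWeight eX (P.root i.1)) := by
  classical
  obtain ⟨A, hA⟩ := exists_conj_le_diagonalSubgroup hT.2.1 hT.2.2
  have hA' : T.map (MulAut.conj A : GL n k →* GL n k) ≤ diagonalSubgroup n k := hA
  set γ : kˣ →* ↥T := cocharOfCoweight eY y with hγdef
  have hγ : IsAlgebraicCochar γ := (Additive.toMul (eY.symm y)).2
  set m : n → ℤ := cocharWeight A hA' γ with hmdef
  -- `Lie(U(y))` is `Ad(T)`-stable and lies in `Lie(G)`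
  set W := lieAlgebraGL (posRootGroup G P u y) with hWdef
  have hWT : ∀ t : ↥T, ∀ B ∈ W, adGL (t : GL n k) B ∈ W := by
    intro t B hB
    rw [adGL_apply]
    exact conj_mem_lieAlgebraGL_of_forall_mem (fun x hx => conj_mem_posRootGroup h hu y t.2 hx) hB
  have hWG : W ≤ lieAlgebraGL G := lieAlgebraGL_mono (posRootGroup_le P u y)
  -- decompose into weight components
  rw [← iSup_inf_adWeightSpace_eq T hT.2.2 W hWT]
  refine iSup_le fun w => ?_
  by_cases hbot : W ⊓ adWeightSpace T w = ⊥
  · rw [hbot]; exact bot_le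
  obtain ⟨B, ⟨hBW, hBw⟩, hB0⟩ := (Submodule.ne_bot_iff _).1 hbot
  -- the weight is an algebraic character `χ`
  have hχalg : IsAlgebraicChar (adWeightChar hBw hB0) := isAlgebraicChar_adWeightChar hBw hB0
  set χ : ↥(characterLattice T) := ⟨adWeightChar hBw hB0, hχalg⟩ with hχdef
  have hwχ : adWeightSpace T w = weightSpaceGL T (χ : ↥T →* kˣ) := by
    rw [weightSpaceGL_eq_adWeightSpace]
    rfl
  -- a non-zero entry of `C = A B A⁻¹`
  set C : Matrix n n k := (A : Matrix n n k) * B * ((A⁻¹ : GL n k) : Matrix n n k) with hCdef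
  have hC0 : C ≠ 0 := by
    intro hC
    apply hB0
    have : B = ((A⁻¹ : GL n k) : Matrix n n k) * C * (A : Matrix n n k) := by
      rw [hCdef]
      simp [Matrix.mul_assoc]
    rw [this, hC, Matrix.mul_zero, Matrix.zero_mul]
  obtain ⟨p, q, hCpq⟩ : ∃ p q, C p q ≠ 0 := by
    by_contra hall
    push Not at hall
    exact hC0 (Matrix.ext fun p q => by rw [hall p q]; rfl)
  have hbpq : -m p < -m q := by
    by_contra hn
    exact hCpq (conj_apply_eq_zero_of_mem_lieAlgebraGL_posRootGroup h hu y A hA' hBW hn)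
  -- the coordinate characters of the diagonal frame
  set χd : n → (↥T →* kˣ) := fun r => (diagEntryChar hA' r).comp (conjEquiv A T).toMonoidHom
    with hχddef
  have hχd : ∀ r, IsAlgebraicChar (χd r) := fun r =>
    (isAlgebraicChar_diagEntryChar hA' r).comp_conjEquiv A
  have hmχd : ∀ r, charPairingInt (χd r) γ = m r := fun r =>
    charPairingInt_comp_conjEquiv A (diagEntryChar hA' r) γ
  -- torus relation conjugated by `A`: `χd p t · C_pq · (χd q t)⁻¹ = χ t · C_pq`
  have hrel : ∀ t : ↥T,
      ((χd p t : kˣ) : k) * C p q * (((χd q t : kˣ) : k))⁻¹ = (((χ : ↥T →* kˣ) t : kˣ) : k) * C p q := by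
    intro t
    have hBt : ((t : GL n k) : Matrix n n k) * B * (((t : GL n k)⁻¹ : GL n k) : Matrix n n k) =
        (((χ : ↥T →* kˣ) t : kˣ) : k) • B := by
      rw [mem_adWeightSpace_iff.1 hBw t]
      rfl
    have e1 : ((A * (t : GL n k) * A⁻¹ : GL n k) : Matrix n n k) * C *
        ((A * ((t⁻¹ : ↥T) : GL n k) * A⁻¹ : GL n k) : Matrix n n k) =
        (A : Matrix n n k) * (((t : GL n k) : Matrix n n k) * B *
          (((t : GL n k)⁻¹ : GL n k) : Matrix n n k)) * ((A⁻¹ : GL n k) : Matrix n n k) := by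
      simp only [hCdef, Units.val_mul, Subgroup.coe_inv, Matrix.mul_assoc, Units.inv_mul_cancel_left]
    have kmat : ((A * (t : GL n k) * A⁻¹ : GL n k) : Matrix n n k) * C *
        ((A * ((t⁻¹ : ↥T) : GL n k) * A⁻¹ : GL n k) : Matrix n n k) =
        (((χ : ↥T →* kˣ) t : kˣ) : k) • C := by
      rw [e1, hBt, Matrix.mul_smul, Matrix.smul_mul, ← hCdef]
    rw [conj_torus_eq_diagonal A hA' t, conj_torus_inv_eq_diagonal A hA' t] at kmat
    have kij := congr_fun (congr_fun kmat p) q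
    rw [Matrix.mul_diagonal, Matrix.diagonal_mul, Matrix.smul_apply, smul_eq_mul] at kij
    exact kij
  -- hence `χ = χd p · (χd q)⁻¹` and `⟨χ, y⟩ = m p - m q > 0`
  have hχeq : (χ : ↥T →* kˣ) = χd p * (χd q)⁻¹ := by
    refine MonoidHom.ext fun t => Units.ext ?_
    rw [MonoidHom.mul_apply, MonoidHom.inv_apply, Units.val_mul, Units.val_inv_eq_inv_val]
    have e := hrel t
    rw [mul_right_comm] at e
    exact (mul_right_cancel₀ hCpq e).symm
  have hpos : 0 < charPairingInt (χ : ↥T →* kˣ) γ := by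
    rw [hχeq, charPairingInt_mul_left (hχd p) (hχd q).inv hγ, charPairingInt_inv_left (hχd q) hγ,
      hmχd, hmχd]
    omega
  -- `χ` is a non-zero weight, hence a root `α_i` with `⟨α_i, y⟩ > 0`
  have hχ1 : (χ : ↥T →* kˣ) ≠ 1 := by
    intro h1
    rw [h1, charPairingInt_one_left hγ] at hpos
    exact lt_irrefl _ hpos
  have hχP : χ ∈ lieWeights G T :=
    mem_lieWeights_iff.2 ⟨hχ1, B, hWG hBW, hB0, by rw [← hwχ]; exact hBw⟩
  have hχR : χ ∈ roots G T := hPR hχP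
  obtain ⟨i, hi⟩ : ∃ i, P.root i = eX (Additive.ofMul χ) := by
    have hmem : eX (Additive.ofMul χ) ∈ Set.range P.root := by
      rw [h.range_root]; exact ⟨χ, hχR, rfl⟩
    exact hmem
  have hαi : charOfWeight eX (P.root i) = (χ : ↥T →* kˣ) := by
    simp [charOfWeight, hi]
  have hipos : 0 < P.root' i y := by
    rw [← h.charPairingInt_charOfWeight_cocharOfCoweight i y, hαi]
    exact hpos
  -- the component lies in `𝔤_{α_i}`
  refine le_iSup_of_le ⟨i, hipos⟩ ?_
  rintro B' ⟨hB'W, hB'w⟩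
  refine ⟨hWG hB'W, ?_⟩
  change B' ∈ weightSpaceGL T (charOfWeight eX (P.root i))
  rw [hαi, ← hwχ]
  exact hB'w

/-- **`dim U(y) ≤ |R⁺(y)|` when `P ⊆ R` and the root spaces are lines** (every characteristic;
the characteristic-free form of `zdim_posRootGroup_le`): with
`Lie(U(y)) ⊆ ⨁_{⟨α_i, y⟩ > 0} 𝔤_{α_i}` (`lieAlgebraGL_posRootGroup_le_of_subset`), `dim 𝔤_{α_i} ≤ 1`
and `dim U(y) = dim Lie(U(y))` (4.4.6, `IsZConnected.finrank_lieAlgebraGL_eq`), the dimension of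
`U(y)` is at most the number of `y`-positive roots (Springer 8.2.4, proof: "`dim U_n = |R̃⁺_n|`").
[cite: SpringerLAG1998, 8.2.4 (proof) and 8.1.3 (ii)] -/
theorem zdim_posRootGroup_le_of_subset [IsAlgClosed k] [Fintype ι] (hG : IsAlgebraicSubgroup G)
    (hPR : lieWeights G T ⊆ roots G T) (hT : IsTorusSubgroup T) (h : IsRootDatumOf G T P eX eY) (u : ι → Multiplicative k →* ↥G)
    (hu : ∀ i, IsRootHom G T h.le (charOfWeight eX (P.root i)) (u i)) (y : Y)
    (hdim : ∀ i, Module.finrank k ↥(lieWeightSpace G T (charOfWeight eX (P.root i))) ≤ 1) :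
    (isZConnected_posRootGroup (P := P) hG hu y).zdim ≤
      (Finset.univ.filter fun i => 0 < P.root' i y).card := by
  classical
  have hU := isZConnected_posRootGroup (P := P) hG hu y
  have hfin := hU.finrank_lieAlgebraGL_eq
  rw [← hfin.2]
  haveI := hfin.1
  -- the family of positive root spaces is independent
  let Nf : {i : ι // 0 < P.root' i y} → Submodule k (Matrix n n k) := fun i =>
    lieWeightSpace G T (charOfWeight eX (P.root i.1))
  have hind : iSupIndep Nf := by
    let wt : {i : ι // 0 < P.root' i y} → (↥T → k) := fun i t =>
      ((charOfWeight eX (P.root i.1) t : kˣ) : k)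
    have hwt : Function.Injective wt := by
      intro i j hij
      have hc : charOfWeight eX (P.root i.1) = charOfWeight eX (P.root j.1) :=
        MonoidHom.ext fun t => Units.ext (congrFun hij t)
      exact Subtype.ext (P.root.injective (charOfWeight_injective eX hc))
    refine ((iSupIndep_adWeightSpace T hT.2.2).comp hwt).mono fun i => ?_
    change lieWeightSpace G T (charOfWeight eX (P.root i.1)) ≤
      adWeightSpace T fun t => ((charOfWeight eX (P.root i.1) t : kˣ) : k)
    rw [← weightSpaceGL_eq_adWeightSpace]
    exact inf_le_right
  have hle := lieAlgebraGL_posRootGroup_le_of_subset hPR hT h u hu y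
  have hsup : (⨆ i : {i : ι // 0 < P.root' i y}, Nf i) = ⨆ i ∈ (Finset.univ : Finset _), Nf i := by
    simp
  calc Module.finrank k ↥(lieAlgebraGL (posRootGroup G P u y))
      ≤ Module.finrank k ↥(⨆ i : {i : ι // 0 < P.root' i y}, Nf i) := Submodule.finrank_mono hle
    _ = ∑ i ∈ (Finset.univ : Finset {i : ι // 0 < P.root' i y}), Module.finrank k ↥(Nf i) := by
        rw [hsup]; exact finrank_biSup_eq_sum_of_iSupIndep' hind _
    _ ≤ ∑ _i ∈ (Finset.univ : Finset {i : ι // 0 < P.root' i y}), 1 :=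
        Finset.sum_le_sum fun i _ => hdim i.1
    _ = (Finset.univ.filter fun i => 0 < P.root' i y).card := by
        rw [Finset.sum_const, smul_eq_mul, mul_one, Finset.card_univ, Fintype.card_subtype]


/-- **`U(y) = ∏_{i ∈ l} U_{α_i}` when `P ⊆ R` and the root spaces are lines, every
characteristic** (the surjectivity half of Springer 8.2.1 by a dimension count; the
characteristic-free form of `posRootGroup_subset_range_rootProd`). Let `G ≤ GL n k` be algebraic
over an algebraically closed field, `T ≤ G` a torus with `P(G, T) ⊆ R(G, T)`, `P` a root datum of
`(G, T)` (finitely many roots) with root homomorphisms `u_i`, `y` a coweight, `l` a numbering of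
the `y`-positive roots, and suppose `dim 𝔤_{α_i} ≤ 1` for all `i`. Then every element of
`U(y) = ⟨u_i(𝔾ₐ) : ⟨α_i, y⟩ > 0⟩` is an ordered product `∏_{i ∈ l} u_i(x_i)`: the image
`Z = φ_l(k^m)` is closed with coordinate ring `k[Z] ≅ k[X_1, …, X_m]` (polynomial left inverse,
now `exists_polyRetraction_prod_rootHom'`), so `𝓘(Z)` is prime and `dim k[Z] = m`, while `U(y)`
is a connected algebraic group of dimension `≤ m` (`zdim_posRootGroup_le_of_subset`); `Z ⊊ U(y)`
would give `dim k[Z] < dim U(y) ≤ m` (1.8.2). [cite: SpringerLAG1998, Prop 8.2.1] -/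
theorem posRootGroup_subset_range_rootProd_of_subset [IsAlgClosed k] [Fintype ι]
    (hG : IsAlgebraicSubgroup G) (hPR : lieWeights G T ⊆ roots G T) (hT : IsTorusSubgroup T) (h : IsRootDatumOf G T P eX eY)
    (u : ι → Multiplicative k →* ↥G) (hu : ∀ i, IsRootHom G T h.le (charOfWeight eX (P.root i)) (u i))
    (y : Y) (l : List ι) (hl : l.Nodup) (hl' : ∀ i, i ∈ l ↔ 0 < P.root' i y)
    (hdim : ∀ i, Module.finrank k ↥(lieWeightSpace G T (charOfWeight eX (P.root i))) ≤ 1) :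
    (posRootGroup G P u y : Set (GL n k)) ⊆ Set.range (rootProd u l) := by
  classical
  -- polynomial data
  choose Pu hPu using fun i => (hu i).1
  obtain ⟨q, hq⟩ := exists_polyRetraction_prod_rootHom' hT h u hu y l hl fun i hi => (hl' i).mp hi
  have hq' : ∀ (x : ι → k), ∀ i ∈ l, MvPolynomial.eval (glCoordFun (rootProd u l x)) (q i) = x i :=
    hq
  set Z : Set (GL n k) := Set.range (rootProd u l) with hZdef
  -- `Z ⊆ U(y)`
  have hZU : Z ⊆ posRootGroup G P u y := by
    rintro _ ⟨x, rfl⟩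
    exact rootProd_mem u (fun i hi z => apply_mem_posRootGroup u ((hl' i).mp hi) z) x
  -- dimensions
  have hU : IsZConnected (posRootGroup G P u y) := isZConnected_posRootGroup (P := P) hG hu y
  have hUle : hU.zdim ≤ l.length := by
    have h1 := zdim_posRootGroup_le_of_subset hG hPR hT h u hu y hdim
    have h2 : (Finset.univ.filter fun i => 0 < P.root' i y) = l.toFinset := by
      ext i; simp [hl' i]
    rw [h2, List.toFinset_card_of_nodup hl] at h1
    convert h1
  obtain ⟨hprime, hdimZ⟩ := ringKrullDim_quotient_idealSetGL_range_rootProd hPu l hl hq'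
  -- `Z = U(y)`
  by_contra hne
  have hne' : Z ≠ (posRootGroup G P u y : Set (GL n k)) := fun hEq => hne (hEq ▸ le_rfl)
  have hlt := ringKrullDim_quotient_lt_zdim_of_isPrime hU (range_rootProd_eq_zeroLocusGL hPu l hq')
    hprime hZU hne'
  rw [hdimZ] at hlt
  have : (l.length : ℕ∞) < (hU.zdim : ℕ∞) := by exact_mod_cast hlt
  have : l.length < hU.zdim := by exact_mod_cast this
  omega

end SurjectivityCharFree

/-! ### Springer 8.2.3 in every characteristic from 8.1.2 -/

section MainCharFree

variable {k : Type*} [Field k] {n : Type*} [Fintype n] [DecidableEq n]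
variable {ι X Y : Type*} [AddCommGroup X] [AddCommGroup Y]
variable {G T : Subgroup (GL n k)} [IsMulCommutative ↥T]

/-- **Springer 8.2.3 (the commutator relations, corollary form) in every characteristic, granted
8.1.2.** For `G` connected reductive over an algebraically closed field (any characteristic), `T` a
maximal torus with root datum `P` and roots `α_i ≠ ±α_j`, the commutator group `(U_{α_i}, U_{α_j})`
lies in the subgroup generated by the `U_{c α_i + d α_j}`, `c, d > 0` — the named fact
`rootSubgroup_commutator_le` — granted Springer 8.1.2 (`lieWeights_eq_roots`: `P = R` and
`dim 𝔤_α = 1`). Springer's proof (p. 144) through 8.2.1: choose a coweight `y` positive on `α_i`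
and `α_j` (`RootPairing.exists_root'_pos_and_root'_pos_or`; the degenerate case
`s α_i + t α_j = 0` is trivial); both halves of 8.2.1 hold for `U(y)` —
`exists_polyRetraction_prod_rootHom'` (polynomial left inverse, from the retraction clause of the
root homomorphisms) and `posRootGroup_subset_range_rootProd_of_subset` (surjectivity, by the
dimension count with `P ⊆ R` and `dim 𝔤_α ≤ 1` from 8.1.2) — and the uniqueness of root subgroups
8.1.1 (i) is the theorem `rootSubgroup_unique_holds`; conclude by
`commutator_rootSubgroup_le_of_range_rootProd` (torus equivariance of the polynomial coordinates of
the commutator). [cite: SpringerLAG1998, Prop 8.2.3 (proof), with Prop 8.2.1 and Cor 8.1.2] -/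
theorem rootSubgroup_commutator_le_of_lieWeights_eq_roots
    (h812 : lieWeights_eq_roots (G := G) (T := T)) :
    rootSubgroup_commutator_le (G := G) (T := T) (ι := ι) (X := X) (Y := Y) := by
  intro _ hG hT P eX eY h i j _ _
  classical
  haveI : Finite ι := h.finite_index hG hT
  letI : Fintype ι := Fintype.ofFinite ι
  obtain ⟨hPR, hdim1⟩ := h812 hG hT
  rcases P.exists_root'_pos_and_root'_pos_or i j with ⟨y, hyi, hyj⟩ | ⟨s, t, hs, ht, hst⟩
  · -- root homomorphisms, a numbering of the `y`-positive roots, and 8.2.1 for `U(y)`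
    set u : ι → Multiplicative k →* ↥G := fun m =>
      (h.exists_sl2Hom m).choose.comp unipotentUpperSL2 with hudef
    have hu : ∀ m, IsRootHom G T h.le (charOfWeight eX (P.root m)) (u m) := fun m =>
      (h.exists_sl2Hom m).choose_spec.2.1
    set l : List ι := (Finset.univ.filter fun m => 0 < P.root' m y).toList with hl
    have hln : l.Nodup := Finset.nodup_toList _
    have hl' : ∀ m, m ∈ l ↔ 0 < P.root' m y := fun m => by simp [hl]
    have hdim : ∀ m, Module.finrank k ↥(lieWeightSpace G T (charOfWeight eX (P.root m))) ≤ 1 := by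
      intro m
      obtain ⟨α, hα, hαm⟩ := h.exists_root_eq m
      rw [← hαm]
      exact (hdim1 α hα).le
    exact commutator_rootSubgroup_le_of_range_rootProd rootSubgroup_unique_holds hG hT h u hu y l
      (exists_polyRetraction_prod_rootHom' hT.2.1 h u hu y l hln fun m hm => (hl' m).mp hm)
      (posRootGroup_subset_range_rootProd_of_subset hG.1.1 hPR.le hT.2.1 h u hu y l hln hl' hdim)
      hyi hyj
  · -- degenerate case: `U_{α_i}` and `U_{α_j}` are among the generators
    refine (Subgroup.commutator_le_sup _ _).trans (sup_le ?_ ?_)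
    · refine le_iSup₂_of_le i ⟨s + 1, t, Nat.succ_pos s, ht, ?_⟩ le_rfl
      rw [add_smul, one_smul, add_comm (s • P.root i), add_assoc, hst, add_zero]
    · refine le_iSup₂_of_le j ⟨s, t + 1, hs, Nat.succ_pos t, ?_⟩ le_rfl
      rw [add_smul, one_smul, ← add_assoc, hst, zero_add]

/-- In characteristic `0` the hypothesis of `rootSubgroup_commutator_le_of_lieWeights_eq_roots` is
not needed: there 8.1.1 (i) is a theorem (`rootSubgroup_unique_holds`), so
`rootSubgroup_commutator_le_of_rootSubgroup_unique` closes the fact outright.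
[cite: SpringerLAG1998, Prop 8.2.3] -/
theorem rootSubgroup_commutator_le_of_charZero [CharZero k] :
    rootSubgroup_commutator_le (G := G) (T := T) (ι := ι) (X := X) (Y := Y) :=
  rootSubgroup_commutator_le_of_rootSubgroup_unique rootSubgroup_unique_holds

/-- **Springer 8.2.3 (the commutator relations, corollary form) holds, in every characteristic** —
the discharge of the named fact `rootSubgroup_commutator_le` of `RootSubgroupCommutators.lean`: for
`G ≤ GL n k` connected reductive over an algebraically closed field, `T` a maximal torus with root
datum `P` and roots `α_i ≠ ±α_j`, *"`(U_{α_i}, U_{α_j})` is contained in the group generated by the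
`U_{c α_i + d α_j}`, `c, d > 0`"*. Springer's proof from 8.2.1
(`rootSubgroup_commutator_le_of_lieWeights_eq_roots`), its input 8.1.2 (`P = R`, `dim 𝔤_α = 1`)
being the theorem `lieWeights_eq_roots_holds` (`IsomorphismTheoremUniqueLieHolds.lean`) and 8.1.1 (i)
the theorem `rootSubgroup_unique_holds`.
[cite: SpringerLAG1998, Prop. 8.2.3 (pp. 143–144), with Prop. 8.2.1, Cor. 8.1.2, Prop. 8.1.1 (i)] -/
theorem rootSubgroup_commutator_le_holds :
    rootSubgroup_commutator_le (G := G) (T := T) (ι := ι) (X := X) (Y := Y) :=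
  rootSubgroup_commutator_le_of_lieWeights_eq_roots lieWeights_eq_roots_holds

end MainCharFree


end Literature.NumberTheory.Automorphic
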